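import Summits.Parity.BatemanHorn.Theorems.AlmostPrimeZerosSystemLSDRealSegmentReduction
import Summits.Parity.BatemanHorn.Theorems.AlmostPrimeZerosSystemLSDRealSegmentLinearKernel
import Summits.Parity.BatemanHorn.Theorems.SystemLSDRealSegment.Negative.BetaKernelConstant
import Literature.NumberTheory.Sieve.BatemanHornProofs
import HarnessLib

/-!
# `SystemLSDRealSegment` (stmt-Parity-11292), line `beta-thinned-root-kernel`:
# the forced kernel constant is STRICTLY POSITIVE for every system of total degree `≥ 3` on the segment

Support lemma for the class stub `stub_betaKernel_totalDegree` of the lead's rev L4 skeleton (worker probe of the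
wave 2026-08-16, landed by the lead).  For Bateman–Horn systems with `Σᵢ deg fᵢ ≥ 3` and every `y ∈ (5/4, 7/4)`,
the archimedean constant of `BetaKernelLaw`, `e^{(y−1) log D} Γ(y)^{−k} − Γ(k(y−1)+1)^{−1}` (`D = ∏ deg fᵢ`), is `> 0`:
* some member of degree `≥ 2` ⇒ `D > 1` ⇒ `betaKernelConst_pos_of_one_lt` (landed, log-convexity of `Γ`);
* all members linear ⇒ `D = 1`, `k = Σ deg ≥ 3`, and `Γ(y)^k < Γ(k(y−1)+1)` (STRICT log-convexity of `Γ`,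
  not in Mathlib; proved here on the needed range from crude enclosures through the nodes `Γ(1) = Γ(2) = 1`,
  `Γ(3/2) = √π/2`: `Γ ≤ (1 + √π/2)/2 < 0.944` on `[5/4, 7/4]`, `Γ ≥ 8/(5(1 + √π/2)) > 0.847` on `[7/4, 2]`,
  `Γ ≥ 1` on `[2, ∞)`, and `π < 3.15`).
This closes, for `k ≥ 3`, the strictness gap left open in `Negative/BetaKernelConstant.lean` at `D = 1` (the pair
`k = 2`, `Γ(y)² < Γ(2y−1)`, needs sharper enclosures and is not treated here).
Consequence: no member of the class has an asymptotically negligible kernel (the mechanism of the landed `k = 1`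
linear case `betaKernelLaw_of_natDegree_eq_one`, where the constant is `0`; with `eulerFactor_re_pos` of
`…RealForm`, a normalised kernel tending to `0` would contradict `BetaKernelLaw`), so the class has no cheap
sub-case: every instance asks for a genuine asymptotic of divisor-tuple data beyond level `x`.
-/

open Filter Finset Polynomial
open scoped BigOperators Topology

namespace Summit.Parity.BatemanHorn.Cruxes.SystemLSDRealSegment.BetaThinnedRootKernel

open Literature.NumberTheory.Sieve
open Summit.Parity.BatemanHorn.Theorems.SystemLSDRealSegment.Negative (betaKernelConst_pos_of_one_lt)

noncomputable section

/-- `√π/2 < 0.8875` (`π < 3.15 < 1.775²`). [folklore] -/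
theorem sqrt_pi_div_two_lt : Real.sqrt Real.pi / 2 < 0.8875 := by
  have h : Real.sqrt Real.pi < 1.775 := by
    rw [Real.sqrt_lt' (by norm_num)]
    have := Real.pi_lt_d2
    norm_num at this ⊢; linarith
  linarith

/-- `2/3 < √π/2` (`(4/3)² < 3 < π`). [folklore] -/
theorem two_thirds_lt_sqrt_pi_div_two : 2 / 3 < Real.sqrt Real.pi / 2 := by
  have h : (4 / 3 : ℝ) < Real.sqrt Real.pi := by
    rw [Real.lt_sqrt (by norm_num)]
    have := Real.pi_gt_three
    norm_num at this ⊢; linarith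
  linarith

/-- On the segment `[5/4, 7/4]`: `Γ(y) ≤ (1 + √π/2)/2` (convexity of `Γ` through `Γ(1) = 1`, `Γ(3/2) = √π/2`,
`Γ(2) = 1`). [folklore] -/
theorem Gamma_le_of_mem_segment {y : ℝ} (hy : 5 / 4 ≤ y) (hy' : y ≤ 7 / 4) :
    Real.Gamma y ≤ (1 + Real.sqrt Real.pi / 2) / 2 := by
  have Real_Gamma_three_halves : Real.Gamma (3 / 2) = Real.sqrt Real.pi / 2 := by
    rw [show (3 / 2 : ℝ) = 1 / 2 + 1 by norm_num, Real.Gamma_add_one (by norm_num), Real.Gamma_one_half_eq]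
    ring
  have hc1 : Real.sqrt Real.pi / 2 ≤ 1 := by have := sqrt_pi_div_two_lt; linarith
  have hconv := Real.convexOn_Gamma
  rcases le_total y (3 / 2) with h | h
  · have ha : (0 : ℝ) ≤ 3 - 2 * y := by linarith
    have hb : (0 : ℝ) ≤ 2 * y - 2 := by linarith
    have key := hconv.2 (show (1 : ℝ) ∈ Set.Ioi 0 by norm_num) (show (3 / 2 : ℝ) ∈ Set.Ioi 0 by norm_num)
      ha hb (by ring)
    simp only [smul_eq_mul, Real.Gamma_one, Real_Gamma_three_halves] at key
    rw [show (3 - 2 * y) * 1 + (2 * y - 2) * (3 / 2 : ℝ) = y by ring] at key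
    have hprod := mul_nonneg (show (0 : ℝ) ≤ 2 * y - 5 / 2 by linarith) (sub_nonneg.2 hc1)
    linarith
  · have ha : (0 : ℝ) ≤ 4 - 2 * y := by linarith
    have hb : (0 : ℝ) ≤ 2 * y - 3 := by linarith
    have key := hconv.2 (show (3 / 2 : ℝ) ∈ Set.Ioi 0 by norm_num) (show (2 : ℝ) ∈ Set.Ioi 0 by norm_num)
      ha hb (by ring)
    simp only [smul_eq_mul, Real.Gamma_two, Real_Gamma_three_halves] at key
    rw [show (4 - 2 * y) * (3 / 2 : ℝ) + (2 * y - 3) * 2 = y by ring] at key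
    have hprod := mul_nonneg (show (0 : ℝ) ≤ 7 / 2 - 2 * y by linarith) (sub_nonneg.2 hc1)
    linarith

/-- On `[7/4, 2]`: `Γ(t) ≥ 8/(5(1 + √π/2))` (log-convexity at the midpoint `2` of `t` and `4 − t` gives
`Γ(t)Γ(4−t) ≥ Γ(2)² = 1`, and `Γ(4−t) = (3−t)Γ(3−t) ≤ (3−t)(1 − 2(2−t)(1 − √π/2)) ≤ 5(1 + √π/2)/8`).
[folklore] -/
theorem Gamma_ge_near_two {t : ℝ} (ht : 7 / 4 ≤ t) (ht' : t ≤ 2) :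
    8 / (5 * (1 + Real.sqrt Real.pi / 2)) ≤ Real.Gamma t := by
  have Real_Gamma_three_halves : Real.Gamma (3 / 2) = Real.sqrt Real.pi / 2 := by
    rw [show (3 / 2 : ℝ) = 1 / 2 + 1 by norm_num, Real.Gamma_add_one (by norm_num), Real.Gamma_one_half_eq]
    ring
  have hc1 : Real.sqrt Real.pi / 2 ≤ 1 := by have := sqrt_pi_div_two_lt; linarith
  have hc23 := two_thirds_lt_sqrt_pi_div_two
  have ht0 : 0 < t := by linarith
  have h4t : 0 < 4 - t := by linarith
  have hGt : 0 < Real.Gamma t := Real.Gamma_pos_of_pos ht0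
  have hG4t : 0 < Real.Gamma (4 - t) := Real.Gamma_pos_of_pos h4t
  -- log-convexity at `2 = (t + (4 - t))/2`
  have key := Real.convexOn_log_Gamma.2 (Set.mem_Ioi.2 ht0) (Set.mem_Ioi.2 h4t)
    (show (0 : ℝ) ≤ 1 / 2 by norm_num) (show (0 : ℝ) ≤ 1 / 2 by norm_num) (by norm_num)
  simp only [Function.comp_apply, smul_eq_mul] at key
  rw [show (1 / 2 : ℝ) * t + 1 / 2 * (4 - t) = 2 by ring, Real.Gamma_two, Real.log_one] at key
  have hprod : 1 ≤ Real.Gamma t * Real.Gamma (4 - t) := by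
    have h0 : 0 ≤ Real.log (Real.Gamma t * Real.Gamma (4 - t)) := by
      rw [Real.log_mul hGt.ne' hG4t.ne']; linarith
    exact (Real.log_nonneg_iff (mul_pos hGt hG4t)).1 h0
  -- `Γ(4 - t) = (3 - t) Γ(3 - t)` and `Γ(3 - t) ≤ 1 - 2(2 - t)(1 - √π/2)` (convexity between `1` and `3/2`)
  have h3t : Real.Gamma (4 - t) = (3 - t) * Real.Gamma (3 - t) := by
    rw [show (4 : ℝ) - t = (3 - t) + 1 by ring, Real.Gamma_add_one (by linarith)]
  have hG3t : Real.Gamma (3 - t) ≤ 1 - 2 * (2 - t) * (1 - Real.sqrt Real.pi / 2) := by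
    have ha : (0 : ℝ) ≤ 1 - 2 * (2 - t) := by linarith
    have hb : (0 : ℝ) ≤ 2 * (2 - t) := by linarith
    have k2 := Real.convexOn_Gamma.2 (show (1 : ℝ) ∈ Set.Ioi 0 by norm_num)
      (show (3 / 2 : ℝ) ∈ Set.Ioi 0 by norm_num) ha hb (by ring)
    simp only [smul_eq_mul, Real.Gamma_one, Real_Gamma_three_halves] at k2
    rw [show (1 - 2 * (2 - t)) * 1 + 2 * (2 - t) * (3 / 2 : ℝ) = 3 - t by ring] at k2
    linarith
  have hG4le : Real.Gamma (4 - t) ≤ 5 * (1 + Real.sqrt Real.pi / 2) / 8 := by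
    rw [h3t]
    have h1 : (3 - t) * Real.Gamma (3 - t) ≤ (3 - t) * (1 - 2 * (2 - t) * (1 - Real.sqrt Real.pi / 2)) :=
      mul_le_mul_of_nonneg_left hG3t (by linarith)
    have hu : (0 : ℝ) ≤ 1 / 4 - (2 - t) := by linarith
    have hv : (0 : ℝ) ≤ 1 - 2 * (1 - Real.sqrt Real.pi / 2) * ((2 - t) + 5 / 4) := by
      have := mul_nonneg (sub_nonneg.2 hc1) hu
      linarith
    have h2 := mul_nonneg hu hv
    linarith
  have hpos : 0 < 5 * (1 + Real.sqrt Real.pi / 2) := by positivity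
  rw [div_le_iff₀ hpos]
  calc (8 : ℝ) = 8 * 1 := by ring
    _ ≤ 8 * (Real.Gamma t * Real.Gamma (4 - t)) := by linarith
    _ ≤ 8 * (Real.Gamma t * (5 * (1 + Real.sqrt Real.pi / 2) / 8)) := by gcongr
    _ = Real.Gamma t * (5 * (1 + Real.sqrt Real.pi / 2)) := by ring

/-- **Strict log-convexity of `Γ` on the needed range**: for `k ≥ 3` and `y ∈ (5/4, 7/4)`,
`Γ(y)^k < Γ(k(y−1)+1)`. [folklore] -/
theorem Gamma_pow_lt_Gamma_of_three_le {k : ℕ} (hk : 3 ≤ k) {y : ℝ} (hy : 5 / 4 < y) (hy' : y < 7 / 4) :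
    Real.Gamma y ^ k < Real.Gamma (k * (y - 1) + 1) := by
  have hc := sqrt_pi_div_two_lt
  have hGy0 : 0 < Real.Gamma y := Real.Gamma_pos_of_pos (by linarith)
  have hGy : Real.Gamma y ≤ (1 + Real.sqrt Real.pi / 2) / 2 := Gamma_le_of_mem_segment hy.le hy'.le
  have hGy1 : Real.Gamma y < 1 := by linarith
  have hk3 : (3 : ℝ) ≤ k := by exact_mod_cast hk
  have hpow : Real.Gamma y ^ k ≤ Real.Gamma y ^ 3 := pow_le_pow_of_le_one hGy0.le hGy1.le hk
  have hcube : Real.Gamma y ^ 3 ≤ ((1 + Real.sqrt Real.pi / 2) / 2) ^ 3 := by gcongr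
  have ht74 : 7 / 4 < (k : ℝ) * (y - 1) + 1 := by
    have : 3 * (y - 1) ≤ (k : ℝ) * (y - 1) := mul_le_mul_of_nonneg_right hk3 (by linarith)
    linarith
  rcases le_or_gt 2 ((k : ℝ) * (y - 1) + 1) with h2 | h2
  · have hGt : 1 ≤ Real.Gamma ((k : ℝ) * (y - 1) + 1) := by
      have hmono := Real.Gamma_strictMonoOn_Ici.monotoneOn Set.self_mem_Ici (Set.mem_Ici.2 h2) h2
      rwa [Real.Gamma_two] at hmono
    have hlt : ((1 + Real.sqrt Real.pi / 2) / 2) ^ 3 < 1 := by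
      have h0 : 0 ≤ (1 + Real.sqrt Real.pi / 2) / 2 := by positivity
      have h1 : (1 + Real.sqrt Real.pi / 2) / 2 < 1 := by linarith
      calc ((1 + Real.sqrt Real.pi / 2) / 2) ^ 3 < 1 ^ 3 := by gcongr
        _ = 1 := one_pow 3
    linarith
  · have hGt : 8 / (5 * (1 + Real.sqrt Real.pi / 2)) ≤ Real.Gamma ((k : ℝ) * (y - 1) + 1) :=
      Gamma_ge_near_two ht74.le h2.le
    have hkey : ((1 + Real.sqrt Real.pi / 2) / 2) ^ 3 < 8 / (5 * (1 + Real.sqrt Real.pi / 2)) := by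
      have hpos : 0 < 1 + Real.sqrt Real.pi / 2 := by positivity
      rw [lt_div_iff₀ (by positivity)]
      have h4 : (1 + Real.sqrt Real.pi / 2) ^ 4 < 64 / 5 := by
        have h0 : 0 ≤ 1 + Real.sqrt Real.pi / 2 := hpos.le
        have h1 : 1 + Real.sqrt Real.pi / 2 < 1.8875 := by linarith
        calc (1 + Real.sqrt Real.pi / 2) ^ 4 < (1.8875 : ℝ) ^ 4 := by gcongr
          _ < 64 / 5 := by norm_num
      nlinarith [h4]
    linarith

/-- **The forced kernel constant is STRICTLY POSITIVE throughout the class `Σ deg fᵢ ≥ 3`** on the segment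
`(5/4, 7/4)`: either some member has degree `≥ 2` (`D > 1`, `betaKernelConst_pos_of_one_lt`), or all members are
linear, `D = 1`, `k = Σ deg ≥ 3` and `Γ(y)^k < Γ(k(y−1)+1)` (`Gamma_pow_lt_Gamma_of_three_le`).  Uses only
`IsBatemanHornSystem.natDegree_pos`. [folklore] -/
theorem betaKernelConst_pos_of_totalDegree {k : ℕ} {f : Fin k → ℤ[X]} (hf : IsBatemanHornSystem f)
    (h3 : 3 ≤ ∑ i, (f i).natDegree) {y : ℝ} (hy : 5 / 4 < y) (hy' : y < 7 / 4) :
    (Real.Gamma (k * (y - 1) + 1))⁻¹ <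
      Real.exp ((y - 1) * Real.log (∏ i, ((f i).natDegree : ℝ))) * (Real.Gamma y)⁻¹ ^ k := by
  have hdeg : ∀ i, 1 ≤ (f i).natDegree := fun i => hf.natDegree_pos i
  by_cases hD : ∃ i, 2 ≤ (f i).natDegree
  · obtain ⟨i₀, hi₀⟩ := hD
    have hD1 : (1 : ℝ) < ∏ i, ((f i).natDegree : ℝ) := by
      calc (1 : ℝ) < ((f i₀).natDegree : ℝ) := by exact_mod_cast hi₀
        _ = ∏ i ∈ ({i₀} : Finset (Fin k)), ((f i).natDegree : ℝ) := by simp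
        _ ≤ ∏ i, ((f i).natDegree : ℝ) :=
          Finset.prod_le_prod_of_subset_of_one_le (Finset.subset_univ _) (fun i _ => by positivity)
            fun i _ _ => by exact_mod_cast hdeg i
    exact betaKernelConst_pos_of_one_lt k hD1 (by linarith)
  · push Not at hD
    have hall : ∀ i, (f i).natDegree = 1 := fun i => by have := hdeg i; have := hD i; omega
    have hprod : ∏ i, ((f i).natDegree : ℝ) = 1 := by simp [hall]
    have hk : 3 ≤ k := by simpa [hall] using h3
    rw [hprod, Real.log_one, mul_zero, Real.exp_zero, one_mul, inv_pow]
    have hGy : 0 < Real.Gamma y ^ k := pow_pos (Real.Gamma_pos_of_pos (by linarith)) k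
    have hGt : 0 < Real.Gamma (k * (y - 1) + 1) := by
      refine Real.Gamma_pos_of_pos ?_
      have : (0 : ℝ) ≤ k * (y - 1) := mul_nonneg (Nat.cast_nonneg k) (by linarith)
      linarith
    exact (inv_lt_inv₀ hGt hGy).2 (Gamma_pow_lt_Gamma_of_three_le hk hy hy')

/-- **kernelConst_pos_of_totalDegree** (registered helper of stmt-Parity-11292; closed form of
`betaKernelConst_pos_of_totalDegree`): for every Bateman–Horn system of total degree `≥ 3` and every
`y ∈ (5/4, 7/4)`, `Γ(k(y−1)+1)^{−1} < e^{(y−1) log D} Γ(y)^{−k}`. [folklore] -/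
theorem kernelConst_pos_of_totalDegree : ∀ (k : ℕ) (f : Fin k → ℤ[X]), IsBatemanHornSystem f → 3 ≤ ∑ i, (f i).natDegree → ∀ y : ℝ, 5 / 4 < y → y < 7 / 4 → (Real.Gamma (k * (y - 1) + 1))⁻¹ < Real.exp ((y - 1) * Real.log (∏ i, ((f i).natDegree : ℝ))) * (Real.Gamma y)⁻¹ ^ k :=
  fun _ _ hf h3 _ hy hy' => betaKernelConst_pos_of_totalDegree hf h3 hy hy'

end

end Summit.Parity.BatemanHorn.Cruxes.SystemLSDRealSegment.BetaThinnedRootKernel
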